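import Summits.BirchSwinnertonDyer.Rank1Residual.Partition.CornersSchneider
import Literature.NumberTheory.EllipticCurves.Rank1Residual.X1CoeffOneRiemannSumCertificate
import Literature.NumberTheory.EllipticCurves.Rank1Residual.X1CoeffOneRiemannSumIntegral
import HarnessLib

/-!
# The good ORDINARY axis at `p ≥ 5` modulo ONE RIEMANN-SUM INEQUALITY per type-B rank-one pair:
# the §A headline with the abstract Schneider binder replaced by a finite numerical certificate about
# the tree's own Mazur–Swinnerton-Dyer measure (cell `b2b-bsdres`, RESIDUAL-MAP.md §A row
# 'reducible, anomalous, GV parity holds' × `r = 1` = §I N1′; CLASS-CLOSURE lane N1 / N1′,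
# instrument N1-COEFF1; rmap-1 gen 9)

HONEST FRAMING (run/shared/lean/b2b/bsd-rank1-residual/, verbatim in every file): the goal of the
cell is to DELETE the COMBINATION-SHAPED residual classes of the Birch–Swinnerton-Dyer formula for
ALL analytic-rank `≤ 1` elliptic curves over `ℚ` — "full BSD formula for every rank `≤ 1` curve in
class `C`" assembled STRICTLY from published theorems — so that the rank-`≤ 1` remainder becomes
exactly the CONSTRUCTION-SHAPED classes, which are TYPED (missing-input `Prop`s), NOT attempted.
This is not "finishing BSD". Theorems only; NO definition, NO named fact introduced here; every
published theorem enters as one of the tree's existing named Literature facts BY NAME; nothing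
about any particular curve is asserted; no label changes; nothing is booked by this file; a
certificate row of the lane's instrument is EVIDENCE for the two numerical hypotheses below, never
a kernel fact, and its tier is referee A's.

## What this file records

`Partition/CornersSchneider.lean` (rmap-1 gen 7) proves the §A headline at a good ordinary
`p ≥ 5` in the form: `BSD(E,p)` unless `(X1 ∧ ¬gvpar) ∨ X9`, GRANTED the pair's Schneider
certificate `hSch : ∀ Dh, Dh.IsCanonical → SchneiderConjecture Dh` — an instance of an open
conjecture, needed only on the type-B rank-one pairs (X1 ∧ gvpar forces `r = 1`). The CLASS-CLOSURE
typer cc-typer-6's `Literature/…/Rank1Residual/X1CoeffOneRiemannSumCertificate.lean` (p265604)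
proves, from the tree's truncation bound for the Mazur–Swinnerton-Dyer measure `μ_{f,α}` of the
newform `f` of `E` and its unit root `α` (Stein–Wuthrich 2013 §3 Prop. 3.1 / 3.5 as a tree theorem,
crux stmt-0490), that a uniform measure bound `‖μ_{f,α}(a + pᵐℤ_p)‖ ≤ C` and ONE level `n` with
`C·p⁻ⁿ < ‖RS(1, n)‖` (`RS(1, n) = padicLRiemannSum f α 1 n`, an exact finite sum of plus-symbol
values) give `[T¹]L_p(f, α, T) ≠ 0` and hence — Perrin-Riou 1987 Cor. 1.8 (`hPR`) and GZK — the
Schneider certificate at an X1 pair of analytic rank one (`X1.schneider_of_riemannSum_certificate`).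
This file substitutes that into the gen-7 headline:

* `bsdp_of_classX1_of_gvPar_of_riemannSumCertificate` — X1 ∧ gvpar at `p ≥ 5`, `r ≤ 1`, a newform
  `f` of `E`, the measure bound and ONE Riemann-sum inequality ⇒ `BSD(E,p)` (five named facts:
  Greenberg–Vatsal 2000 Thm. (1.3) `hGV`, Perrin-Riou–Schneider `hS`, Perrin-Riou 1987 `hPR`,
  modularity `hmodP`, GZK `hGZK`);
* `bsdp_goodOrd_of_five_le_of_riemannSumCertificate_sharp` — **non-CM, `r ≤ 1`, good ordinary
  `p ≥ 5`: `BSD(E,p)` unless `(X1 ∧ ¬gvpar) ∨ X9`, granted the NINE named facts of the gen-7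
  headline and, ONLY IF the pair is X1 ∧ gvpar, the existence of a newform `f` with a measure bound
  and one Riemann sum beating the truncation bound** (hypothesis `hcert`, implication-shaped: it
  asks nothing of a pair outside X1 ∧ gvpar); partition form
  `bsdp_or_typeA_or_classX9_of_five_le_of_riemannSumCertificate`.
* APPENDED after cc-typer-6's `X1CoeffOneRiemannSumIntegral` (p273293):
  `bsdp_of_classX1_of_gvPar_of_riemannSumLt`, `bsdp_goodOrd_of_five_le_of_riemannSumLt_sharp`,
  `bsdp_or_typeA_or_classX9_of_five_le_of_riemannSumLt` — the same three theorems with the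
  measure bound `hC` DELETED (at analytic rank one the measure at the unit root is `ℤ_p`-valued
  for free), so the only numerical hypothesis left on an X1 ∧ gvpar pair is ONE bare inequality
  `p⁻ⁿ < ‖RS(1, n)‖` at one level `n`.

So at `p ≥ 5` on the good ordinary axis the only non-published input left outside the type-A /
X9 corner is a FINITE NUMERICAL INEQUALITY about an explicitly defined measure (coordinator
ruling (A): 'published theorems typed as named facts + finite certificates'). What an N1-COEFF1
instrument row supplies is EVIDENCE for `hlt` with `C = p^{c_den}` in the engines' normalisation
(scale-covariant) and for the bound on the delivered levels; the all-level bound is Manin–Drinfeld's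
common denominator (`exists_norm_msdMeasure_le_of_isNewformOf`), explicit only case by case. Per-pair
shape of record (RESIDUAL-MAP §A, rmap-1 gen 8): the whole rank-one X1 residue at `N < 5·10⁵` is,
pair by pair, 'BSD_p modulo ONE Schneider certificate' — here re-expressed as 'modulo one
Riemann-sum inequality'. No mark moves: N1′ stays COMBINATION (certificate-shaped).

References: RESIDUAL-MAP.md §A / §I N1′; `Partition/CornersSchneider.lean` (p247687);
`Literature/…/Rank1Residual/X1CoeffOneRiemannSumCertificate.lean` (p265604);
[SteinWuthrich2013] §3 Prop. 3.1 / 3.5; [PerrinRiou1987] §1.4 Cor. 1.8; [GreenbergVatsal2000]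
Thm. (1.3); [BalakrishnanMullerStein2015] Thm. 1.7; [MazurTateTeitelbaum1986Invent] §I.11–I.13.
-/

noncomputable section

open scoped Classical MatrixGroups ModularForm NumberField

namespace Summit.BirchSwinnertonDyer.Rank1Residual

open CongruenceSubgroup WeierstrassCurve PowerSeries Literature.NumberTheory.EllipticCurves
  Literature.NumberTheory.EllipticCurves.Rank1Residual Literature.NumberTheory.EllipticCurves.ModularForms
  Literature.NumberTheory.EllipticCurves.Wuthrich2014
  Literature.NumberTheory.EllipticCurves.Rank1Residual.Typed

section Curve

variable {W : WeierstrassCurve ℚ} [W.IsElliptic] [W.IsGloballyMinimal] {p : ℕ} [Fact p.Prime]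

/-! ### The type-B part of X1 exits the corner under ONE Riemann-sum inequality -/

/-- **X1 ∧ gvpar ∧ (measure bound + ONE Riemann-sum inequality) ⇒ `BSD(E,p)`** (`p ≥ 5`, `r ≤ 1`;
`f` a newform of `E`): the gen-7 `bsdp_of_classX1_of_gvPar_of_schneider` with its Schneider
certificate SUPPLIED by cc-typer-6's `X1.schneider_of_riemannSum_certificate` (Stein–Wuthrich 2013
§3 truncation bound as a tree theorem + Perrin-Riou 1987 Cor. 1.8 + GZK; the rank is read off
X1 + gvpar). Five named facts. [cite: GreenbergVatsal2000, Thm. (1.3)]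
[cite: PerrinRiou1987, §1.4 Cor. 1.8] [cite: SteinWuthrich2013, §3 Prop. 3.5] -/
theorem bsdp_of_classX1_of_gvPar_of_riemannSumCertificate
    (hGV : GreenbergVatsal2000.thm13_charIdeal_eq_of_gvPar)
    (hS : Schneider1985_order_charGenerator) (hPR : perrinRiou_rankOne_leadingTerms)
    (hmodP : nonempty_modularParametrizationData)
    (hGZK : rank_eq_analyticRank_of_analyticRank_le_one)
    (hr : W.analyticRank ≤ 1) (h5 : 5 ≤ p) (hX1 : ClassX1 W p) (hpar : GVPar W p)
    {N : ℕ} [NeZero N] (f : CuspForm (Gamma0 N) 2) (hf : IsNewformOf W f) {C : ℝ}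
    (hC : ∀ (m : ℕ) (a : ZMod (p ^ m)), ‖msdMeasure f (unitRoot W p : ℚ_[p]) m a‖ ≤ C) {n : ℕ}
    (hlt : C * (p : ℝ) ^ (-n : ℤ) < ‖padicLRiemannSum f (unitRoot W p : ℚ_[p]) 1 n‖) : BSDp W p :=
  bsdp_of_classX1_of_gvPar_of_schneider hGV hS hPR hmodP hGZK hr h5 hX1 hpar
    (X1.schneider_of_riemannSum_certificate hPR hGZK W p hX1 h5
      (analyticRank_eq_one_of_classX1_of_gvPar hr hX1 hpar) f hf hC hlt)

/-! ### The §A headline at `p ≥ 5`, modulo one Riemann-sum inequality per type-B rank-one pair -/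

/-- **SHARP MODULO ONE RIEMANN-SUM INEQUALITY, non-CM: NINE named facts.** For every non-CM `E/ℚ`
(globally minimal `W`) of analytic rank `≤ 1` and every good ORDINARY prime `p ≥ 5`, `BSD(E,p)`
holds unless `(E, p)` is Eisenstein-anomalous of TYPE A (`ClassX1 ∧ ¬GVPar`) or lies in X9 — granted
the nine named facts of `CornersSchneider.bsdp_goodOrd_of_five_le_of_schneider_sharp` and, ONLY
WHEN the pair is X1 ∧ gvpar (type B, hence `r = 1`), a newform `f` of `E` with a uniform bound `C`
on its Mazur–Swinnerton-Dyer measure at the unit root and ONE level `n` at which the first Riemann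
sum beats the truncation bound (`hcert`; implication-shaped — outside X1 ∧ gvpar it asks nothing).
Outside X1: `CornersSharp.bsdp_goodOrd_of_five_le_sharp`; on X1 ∧ gvpar:
`bsdp_of_classX1_of_gvPar_of_riemannSumCertificate`. RESIDUAL-MAP §A / §I N1′ in kernel form with a
finite numerical certificate in place of the Schneider binder. [folklore] -/
theorem bsdp_goodOrd_of_five_le_of_riemannSumCertificate_sharp
    (hBCS : BurungaleCastellaSkinner2025.cor131_padicValRat_bsd_rank_le_one)
    (hGZK : rank_eq_analyticRank_of_analyticRank_le_one)
    (hCGS : CastellaGrossiSkinner2025.thmD_padicValRat_bsd_rank_le_one)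
    (hGV : GreenbergVatsal2000.thm13_charIdeal_eq_of_gvPar) (hGr : greenberg_charValue_rankZero)
    (hmod : hasEntireLFunction_rat) (hmodP : nonempty_modularParametrizationData)
    (hS : Schneider1985_order_charGenerator) (hPR : perrinRiou_rankOne_leadingTerms)
    (hcm : ¬ W.HasCM) (hr : W.analyticRank ≤ 1) (hgo : GoodOrd W p) (h5 : 5 ≤ p)
    (hcert : ClassX1 W p → GVPar W p →
      ∃ (N : ℕ) (_ : NeZero N) (f : CuspForm (Gamma0 N) 2), IsNewformOf W f ∧
        ∃ (C : ℝ) (n : ℕ), (∀ (m : ℕ) (a : ZMod (p ^ m)), ‖msdMeasure f (unitRoot W p : ℚ_[p]) m a‖ ≤ C) ∧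
          C * (p : ℝ) ^ (-n : ℤ) < ‖padicLRiemannSum f (unitRoot W p : ℚ_[p]) 1 n‖)
    (hA : ¬ (ClassX1 W p ∧ ¬ GVPar W p)) (hX9 : ¬ ClassX9 W p) : BSDp W p := by
  by_cases hX1 : ClassX1 W p
  · have hpar : GVPar W p := by
      by_contra hnp
      exact hA ⟨hX1, hnp⟩
    obtain ⟨N, hN, f, hf, C, n, hC, hlt⟩ := hcert hX1 hpar
    exact bsdp_of_classX1_of_gvPar_of_riemannSumCertificate hGV hS hPR hmodP hGZK hr h5 hX1 hpar f hf
      hC hlt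
  · exact bsdp_goodOrd_of_five_le_sharp hBCS hGZK hCGS hGV hGr hmod hmodP hcm hr hgo h5 hX1 hX9

/-- **Partition form at `p ≥ 5` modulo one Riemann-sum inequality (non-CM, good ordinary):
`BSD(E,p) ∨ (X1 ∧ ¬gvpar) ∨ X9`** from the same nine named facts and the implication-shaped
certificate hypothesis. [folklore] -/
theorem bsdp_or_typeA_or_classX9_of_five_le_of_riemannSumCertificate
    (hBCS : BurungaleCastellaSkinner2025.cor131_padicValRat_bsd_rank_le_one)
    (hGZK : rank_eq_analyticRank_of_analyticRank_le_one)
    (hCGS : CastellaGrossiSkinner2025.thmD_padicValRat_bsd_rank_le_one)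
    (hGV : GreenbergVatsal2000.thm13_charIdeal_eq_of_gvPar) (hGr : greenberg_charValue_rankZero)
    (hmod : hasEntireLFunction_rat) (hmodP : nonempty_modularParametrizationData)
    (hS : Schneider1985_order_charGenerator) (hPR : perrinRiou_rankOne_leadingTerms)
    (hcm : ¬ W.HasCM) (hr : W.analyticRank ≤ 1) (hgo : GoodOrd W p) (h5 : 5 ≤ p)
    (hcert : ClassX1 W p → GVPar W p →
      ∃ (N : ℕ) (_ : NeZero N) (f : CuspForm (Gamma0 N) 2), IsNewformOf W f ∧
        ∃ (C : ℝ) (n : ℕ), (∀ (m : ℕ) (a : ZMod (p ^ m)), ‖msdMeasure f (unitRoot W p : ℚ_[p]) m a‖ ≤ C) ∧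
          C * (p : ℝ) ^ (-n : ℤ) < ‖padicLRiemannSum f (unitRoot W p : ℚ_[p]) 1 n‖) :
    BSDp W p ∨ (ClassX1 W p ∧ ¬ GVPar W p) ∨ ClassX9 W p := by
  by_cases hA : ClassX1 W p ∧ ¬ GVPar W p
  · exact Or.inr (Or.inl hA)
  · by_cases hX9 : ClassX9 W p
    · exact Or.inr (Or.inr hX9)
    · exact Or.inl (bsdp_goodOrd_of_five_le_of_riemannSumCertificate_sharp hBCS hGZK hCGS hGV hGr hmod
        hmodP hS hPR hcm hr hgo h5 hcert hA hX9)

/-! ### Appended (rmap-1 gen 9, after cc-typer-6's `X1CoeffOneRiemannSumIntegral`, p273293): at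
positive analytic rank the Mazur–Swinnerton-Dyer measure at the unit root is `ℤ_p`-valued for free
(`L(E,1) = 0`, `norm_msdMeasure_unitRoot_le_one_of_analyticRank_eq_one`), so the measure bound `C`
of the certificate above is NOT needed — ONE bare inequality `p⁻ⁿ < ‖RS(1, n)‖` at ONE level `n`
suffices. The three theorems below are the three above with `hC` deleted. -/

/-- **X1 ∧ gvpar ∧ ONE bare Riemann-sum inequality ⇒ `BSD(E,p)`** (`p ≥ 5`, `r ≤ 1`; `f` a newform
of `E`): as `bsdp_of_classX1_of_gvPar_of_riemannSumCertificate` but with the Schneider certificate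
supplied by cc-typer-6's `X1.schneider_of_riemannSum_lt` — no measure bound is asked (it is
automatic at analytic rank one, which X1 ∧ gvpar ∧ `r ≤ 1` forces). Five named facts.
[cite: GreenbergVatsal2000, Thm. (1.3)] [cite: PerrinRiou1987, §1.4 Cor. 1.8]
[cite: SteinWuthrich2013, §3 Prop. 3.5] -/
theorem bsdp_of_classX1_of_gvPar_of_riemannSumLt
    (hGV : GreenbergVatsal2000.thm13_charIdeal_eq_of_gvPar)
    (hS : Schneider1985_order_charGenerator) (hPR : perrinRiou_rankOne_leadingTerms)
    (hmodP : nonempty_modularParametrizationData)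
    (hGZK : rank_eq_analyticRank_of_analyticRank_le_one)
    (hr : W.analyticRank ≤ 1) (h5 : 5 ≤ p) (hX1 : ClassX1 W p) (hpar : GVPar W p)
    {N : ℕ} [NeZero N] (f : CuspForm (Gamma0 N) 2) (hf : IsNewformOf W f) {n : ℕ}
    (hlt : (p : ℝ) ^ (-n : ℤ) < ‖padicLRiemannSum f (unitRoot W p : ℚ_[p]) 1 n‖) : BSDp W p :=
  bsdp_of_classX1_of_gvPar_of_schneider hGV hS hPR hmodP hGZK hr h5 hX1 hpar
    (X1.schneider_of_riemannSum_lt hPR hGZK W p hX1 h5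
      (analyticRank_eq_one_of_classX1_of_gvPar hr hX1 hpar) f hf hlt)

/-- **SHARP MODULO ONE BARE RIEMANN-SUM INEQUALITY, non-CM: NINE named facts.** For every non-CM
`E/ℚ` (globally minimal `W`) of analytic rank `≤ 1` and every good ORDINARY prime `p ≥ 5`,
`BSD(E,p)` holds unless `(E, p)` is Eisenstein-anomalous of TYPE A (`ClassX1 ∧ ¬GVPar`) or lies in
X9 — granted the nine named facts of the gen-7 headline and, ONLY WHEN the pair is X1 ∧ gvpar
(type B, hence `r = 1`), a newform `f` of `E` with ONE level `n` at which the first Riemann sum of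
its Mazur–Swinnerton-Dyer measure at the unit root satisfies `p⁻ⁿ < ‖RS(1, n)‖` (`hcert`,
implication-shaped; NO measure bound). This is `bsdp_goodOrd_of_five_le_of_riemannSumCertificate_sharp`
with the bound `C` deleted. [folklore] -/
theorem bsdp_goodOrd_of_five_le_of_riemannSumLt_sharp
    (hBCS : BurungaleCastellaSkinner2025.cor131_padicValRat_bsd_rank_le_one)
    (hGZK : rank_eq_analyticRank_of_analyticRank_le_one)
    (hCGS : CastellaGrossiSkinner2025.thmD_padicValRat_bsd_rank_le_one)
    (hGV : GreenbergVatsal2000.thm13_charIdeal_eq_of_gvPar) (hGr : greenberg_charValue_rankZero)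
    (hmod : hasEntireLFunction_rat) (hmodP : nonempty_modularParametrizationData)
    (hS : Schneider1985_order_charGenerator) (hPR : perrinRiou_rankOne_leadingTerms)
    (hcm : ¬ W.HasCM) (hr : W.analyticRank ≤ 1) (hgo : GoodOrd W p) (h5 : 5 ≤ p)
    (hcert : ClassX1 W p → GVPar W p →
      ∃ (N : ℕ) (_ : NeZero N) (f : CuspForm (Gamma0 N) 2), IsNewformOf W f ∧
        ∃ n : ℕ, (p : ℝ) ^ (-n : ℤ) < ‖padicLRiemannSum f (unitRoot W p : ℚ_[p]) 1 n‖)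
    (hA : ¬ (ClassX1 W p ∧ ¬ GVPar W p)) (hX9 : ¬ ClassX9 W p) : BSDp W p := by
  by_cases hX1 : ClassX1 W p
  · have hpar : GVPar W p := by
      by_contra hnp
      exact hA ⟨hX1, hnp⟩
    obtain ⟨N, hN, f, hf, n, hlt⟩ := hcert hX1 hpar
    exact bsdp_of_classX1_of_gvPar_of_riemannSumLt hGV hS hPR hmodP hGZK hr h5 hX1 hpar f hf hlt
  · exact bsdp_goodOrd_of_five_le_sharp hBCS hGZK hCGS hGV hGr hmod hmodP hcm hr hgo h5 hX1 hX9

/-- **Partition form at `p ≥ 5` modulo one bare Riemann-sum inequality (non-CM, good ordinary):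
`BSD(E,p) ∨ (X1 ∧ ¬gvpar) ∨ X9`** — `bsdp_or_typeA_or_classX9_of_five_le_of_riemannSumCertificate`
with the bound `C` deleted. [folklore] -/
theorem bsdp_or_typeA_or_classX9_of_five_le_of_riemannSumLt
    (hBCS : BurungaleCastellaSkinner2025.cor131_padicValRat_bsd_rank_le_one)
    (hGZK : rank_eq_analyticRank_of_analyticRank_le_one)
    (hCGS : CastellaGrossiSkinner2025.thmD_padicValRat_bsd_rank_le_one)
    (hGV : GreenbergVatsal2000.thm13_charIdeal_eq_of_gvPar) (hGr : greenberg_charValue_rankZero)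
    (hmod : hasEntireLFunction_rat) (hmodP : nonempty_modularParametrizationData)
    (hS : Schneider1985_order_charGenerator) (hPR : perrinRiou_rankOne_leadingTerms)
    (hcm : ¬ W.HasCM) (hr : W.analyticRank ≤ 1) (hgo : GoodOrd W p) (h5 : 5 ≤ p)
    (hcert : ClassX1 W p → GVPar W p →
      ∃ (N : ℕ) (_ : NeZero N) (f : CuspForm (Gamma0 N) 2), IsNewformOf W f ∧
        ∃ n : ℕ, (p : ℝ) ^ (-n : ℤ) < ‖padicLRiemannSum f (unitRoot W p : ℚ_[p]) 1 n‖) :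
    BSDp W p ∨ (ClassX1 W p ∧ ¬ GVPar W p) ∨ ClassX9 W p := by
  by_cases hA : ClassX1 W p ∧ ¬ GVPar W p
  · exact Or.inr (Or.inl hA)
  · by_cases hX9 : ClassX9 W p
    · exact Or.inr (Or.inr hX9)
    · exact Or.inl (bsdp_goodOrd_of_five_le_of_riemannSumLt_sharp hBCS hGZK hCGS hGV hGr hmod hmodP
        hS hPR hcm hr hgo h5 hcert hA hX9)

end Curve

end Summit.BirchSwinnertonDyer.Rank1Residual
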